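import Literature.NumberTheory.EllipticCurves.DeShalit1987.KatzDistributionFromLMeasure
import Literature.NumberTheory.EllipticCurves.ProfiniteGroupDistributionTwisting
import HarnessLib

/-!
# Translation of a measure on `Γ_K` by a group element: the `(m, 0)`-identities of de Shalit II.4.14
# transport with `Ω_p ↦ t·Ω_p`, and the attached `ℤ_p²`-distribution changes by a unit character factor
# (de Shalit 1987, II.4.12 twisting with `N𝔞 := 0`; II.4.17 (54)) — proofs only

Topic `NumberTheory/EllipticCurves/DeShalit1987`. PROOFS ONLY over existing definitions
(`GroupDistribution.twisting`, `katzDistribution₂`, `interpolationValue`); no definition, no named fact, no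
`sorry`, no instance.

WHAT AND WHY (cell `bsd-print-cf2`, director-bsd 2026-08-30T02:44:19Z «both 20368 consumers being invariant
under the unit ambiguity is the load-bearing claim — keep its kernel certificate next to the memo»; LEAD memo
`Cruxes/KatzDistributionsAtTwoPrint/LEAD-MEMO-KATZ-RANGE-g17.md` §3/§4/§6; planner (T4)). De Shalit's twisting
operator with constant `0`, `twisting h 0 μ = δ_h * μ`, IS left translation: `∫ f d(δ_{h,0} μ) = ∫ f(h·x) dμ(x)`
(`integral_twisting`). Hence, for a multiplicative tower-continuous test function `e` (a `p`-adic avatar),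
`∫ e d(δ_{h,0}μ) = e(h) · ∫ e dμ`. Two consequences, both kernel-checked here:

* §2 **the `(m, 0)`-identities transport with `Ω_p ↦ t·Ω_p`** (`integral_avatar_twisting_zero_of_forall`):
  if `μ` satisfies `∫ ê dμ = ι⁻¹(interpolationValue p v v̄ S ε m 0 Ω δ L(ε,0)) · Ω_p^m` for every range triple
  `(ε, e, m)` (type `(−m, 0)`, `m₀ ≤ m`, unramified off `S ∪ {v̄}`, avatar outside `S`, tower-continuous) and
  `h ∈ Γ_K` has `ê(h) = t^m` on the same range (this is the case for `h` in the inertia group at `v` inside the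
  ray kernel, `t = κ_v(h)^{∓1}`: `HeckeCharacterRayKernelAvatar.avatarValueAt_eq_of_mem_ker_rayClassField`; the
  instantiation is not made here), then `δ_{h,0}μ` satisfies the SAME identities with `t·Ω_p` in place of `Ω_p`,
  along the same tower and with the same bound (`twisting_zero_bound`). So the `(m, 0)` data alone pin `Ω_p`
  at best up to such `t` — the reason the `j = 0` twin of the print leaf `KatzDistributionsAtTwoPrint` cannot feed
  an «upgrade to all `j`» stub (memo §3).
* §3 **the attached distribution on `ℤ_p²` changes by a unit character factor**
  (`integral_katzDistribution₂_twisting_zero`): for every continuous character `F` of `ℤ_p²`,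
  `∫ F d(π_*(l·δ_{h,0}μ)) = l(h) · F(κ₁h, κ₂h) · ∫ F d(π_*(l·μ))`, with `‖l(h)‖ = ‖F(κ₁h, κ₂h)‖ = 1`
  (`IsContinuousChar₂.norm_apply_eq_one`); hence the two-variable Amice transforms take, at every character
  point `(F(1,0) − 1, F(0,1) − 1)` of the open bidisc, values of THE SAME NORM
  (`norm_integral_katzDistribution₂_twisting_zero`, `hasValueAt₂_amice₂Int_twisting_zero`) — the invariance the two
  consumers of the leaf inside crux `SplitBadTwoRankOneOfFacts` use (the value formula reads a norm; the
  main-conjecture clause reads the ideal `(G₂)`, and `(G₂) = (u·G₂)` for the unit `u = l(h)(1+T₁)^{κ₁h}(1+T₂)^{κ₂h}`).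

References: [deShalit1987] E. de Shalit, *Iwasawa theory of elliptic curves with complex multiplication* (1987),
II.4.12 (p. 66–68: `δ_𝔞 = σ_𝔞 − N𝔞`), II.4.14 (36) (p. 71), II.4.16 (49)–(50) (p. 76–77), II.4.17 (54) (p. 78);
[Washington1997] L. Washington, *Introduction to Cyclotomic Fields*, §7.2, §13.1.
-/

noncomputable section

open Filter Topology
open NumberField IsDedekindDomain Field
open Literature.NumberTheory.GaloisRepresentations

namespace Literature.NumberTheory.EllipticCurves

/-! ### §1. `δ_{h,0} μ` is left translation -/

namespace GroupDistribution

variable {G : Type*} [Group G] {𝒰 : SubgroupTower G} [∀ n, (𝒰.U n).Normal]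
variable {p : ℕ} [Fact p.Prime]

/-- **`∫ f d(δ_{h,0}μ) = ∫ f(h·x) dμ(x)`**: de Shalit's twisting with constant `0` is left translation by `h`
(`integral_twisting` with `c = 0`). [cite: deShalit1987, II.4.12 (p. 66–68)] -/
theorem integral_twisting_zero (h : G) (D : GroupDistribution 𝒰 ℂ_[p]) {f : G → ℂ_[p]}
    (hf : 𝒰.IsTowerContinuous f) :
    (twisting h 0 D).integral f = D.integral (fun x ↦ f (h * x)) := by
  rw [integral_twisting h 0 D hf, zero_mul, sub_zero]

/-- The bound of `δ_{h,0}μ` is that of `μ`. [cite: deShalit1987, II.4.12 (p. 67)] -/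
theorem twisting_zero_bound (h : G) (D : GroupDistribution 𝒰 ℂ_[p]) : (twisting h 0 D).bound = D.bound := by
  rw [twisting_bound, norm_zero, max_eq_left zero_le_one, one_mul]

/-- **For a multiplicative test function the translate integrates to `f(h) · ∫ f dμ`.**
[cite: deShalit1987, II.4.12 (p. 67–68), II.4.14 Step 1 (29)↔(31) (p. 71)] -/
theorem integral_twisting_zero_of_map_mul (h : G) (D : GroupDistribution 𝒰 ℂ_[p]) {f : G → ℂ_[p]}
    (hf : 𝒰.IsTowerContinuous f) (hmul : ∀ x, f (h * x) = f h * f x) :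
    (twisting h 0 D).integral f = f h * D.integral f := by
  rw [integral_twisting_zero h D hf, ← D.integral_const_mul (f h) hf]
  exact D.integral_congr fun x ↦ hmul x

/-- **Transport of ONE interpolation identity**: if `∫ f dμ = c · Ω_p^m`, `f` is multiplicative and
tower-continuous and `f(h) = t^m`, then `∫ f d(δ_{h,0}μ) = c · (t·Ω_p)^m`. [cite: deShalit1987, II.4.14 (36) (p. 71)] -/
theorem integral_twisting_zero_eq_mul_pow (h : G) (D : GroupDistribution 𝒰 ℂ_[p]) {f : G → ℂ_[p]}
    (hf : 𝒰.IsTowerContinuous f) (hmul : ∀ x, f (h * x) = f h * f x) {c Ωp t : ℂ_[p]} {m : ℕ}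
    (hval : D.integral f = c * Ωp ^ m) (hh : f h = t ^ m) :
    (twisting h 0 D).integral f = c * (t * Ωp) ^ m := by
  rw [integral_twisting_zero_of_map_mul h D hf hmul, hval, hh, mul_pow]
  ring

end GroupDistribution

/-! ### §2. The `(m, 0)`-identities of II.4.14 along a tower of `Γ_K`: transport with `Ω_p ↦ t·Ω_p` -/

section Galois

variable {p : ℕ} [Fact p.Prime] {K : Type} [Field K] [NumberField K]
variable {𝒰 : SubgroupTower (absoluteGaloisGroup K)} [∀ n, (𝒰.U n).Normal]

/-- **THE `(m, 0)`-IDENTITIES DO NOT PIN `Ω_p` BEYOND `t`-AMBIGUITY.** Let `μ` on `Γ_K` along `𝒰` satisfy de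
Shalit's (36)/(50) at every `(ε, e, m)` with `ε` of type `(−m, 0)`, `m₀ ≤ m`, unramified outside `S ∪ {v̄}`, `e`
an avatar of `ε` outside `S`, tower-continuous — with periods `(Ω, δ, Ω_p)`. Let `h ∈ Γ_K` satisfy `ê(h) = t^m` on
the same range. Then the translate `δ_{h,0}μ` satisfies the same identities with `(Ω, δ, t·Ω_p)`. (Typical `h`:
an element of the inertia group at `v` in the ray kernel, `t = κ_v(h)^{∓1}`; memo §3 of the LEAD of crux
`SplitBadTwoRankOneOfFacts`, 2026-08-30.) [cite: deShalit1987, II.4.14 (36) (p. 71), II.4.16 (49)–(50) (p. 76–77)] -/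
theorem integral_avatar_twisting_zero_of_forall {ι : PadicAlgCl p ≃+* ℂ} {v vbar : HeightOneSpectrum (𝓞 K)}
    {S : Finset (HeightOneSpectrum (𝓞 K))} {Ω δ : ℂ} {Ωp t : ℂ_[p]} {m₀ : ℕ}
    {μ : GroupDistribution 𝒰 ℂ_[p]} {h : absoluteGaloisGroup K}
    (hμ : ∀ (ε : HeckeCharacter K) (e : FramedGaloisRep K (PadicAlgCl p) 1) (m : ℕ),
      IsPAdicAvatarOutside S ι ε e → m₀ ≤ m →
      ε.HasInfinityType (fun _ ↦ -(m : ℤ)) (fun _ ↦ ((0 : ℕ) : ℤ)) →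
      (∀ w : HeightOneSpectrum (𝓞 K), w ∉ S → w ≠ vbar → ε.IsUnramifiedAt w) →
      𝒰.IsTowerContinuous (fun σ ↦ avatarValueAt e σ) →
      ∀ hL : LFunction.HasEntireContinuation (heckeLFunction ε),
        μ.integral (fun σ ↦ avatarValueAt e σ) =
          ((ι.symm (DeShalit1987.interpolationValue p v vbar S ε m 0 Ω δ (hL.continuation 0)) :
              PadicAlgCl p) : ℂ_[p]) * Ωp ^ (m + 0))
    (hh : ∀ (ε : HeckeCharacter K) (e : FramedGaloisRep K (PadicAlgCl p) 1) (m : ℕ),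
      IsPAdicAvatarOutside S ι ε e → m₀ ≤ m →
      ε.HasInfinityType (fun _ ↦ -(m : ℤ)) (fun _ ↦ ((0 : ℕ) : ℤ)) →
      (∀ w : HeightOneSpectrum (𝓞 K), w ∉ S → w ≠ vbar → ε.IsUnramifiedAt w) →
      avatarValueAt e h = t ^ m) :
    ∀ (ε : HeckeCharacter K) (e : FramedGaloisRep K (PadicAlgCl p) 1) (m : ℕ),
      IsPAdicAvatarOutside S ι ε e → m₀ ≤ m →
      ε.HasInfinityType (fun _ ↦ -(m : ℤ)) (fun _ ↦ ((0 : ℕ) : ℤ)) →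
      (∀ w : HeightOneSpectrum (𝓞 K), w ∉ S → w ≠ vbar → ε.IsUnramifiedAt w) →
      𝒰.IsTowerContinuous (fun σ ↦ avatarValueAt e σ) →
      ∀ hL : LFunction.HasEntireContinuation (heckeLFunction ε),
        (GroupDistribution.twisting h 0 μ).integral (fun σ ↦ avatarValueAt e σ) =
          ((ι.symm (DeShalit1987.interpolationValue p v vbar S ε m 0 Ω δ (hL.continuation 0)) :
              PadicAlgCl p) : ℂ_[p]) * (t * Ωp) ^ (m + 0) := by
  intro ε e m he hm hinf hunr hcont hL
  rw [Nat.add_zero]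
  refine GroupDistribution.integral_twisting_zero_eq_mul_pow h μ hcont (fun x ↦ avatarValueAt_mul e h x) ?_
    (hh ε e m he hm hinf hunr)
  have := hμ ε e m he hm hinf hunr hcont hL
  rwa [Nat.add_zero] at this

omit [NumberField K] in
/-- The translate lives along the SAME tower with the SAME bound, so the tower clauses (open levels,
`⋂ U_n ⊆ rayKer`) and the integrality clause `‖μ‖ ≤ 1` of the leaf's statement are untouched.
[cite: deShalit1987, II.4.12 (p. 67)] -/
theorem twisting_zero_bound_le_one {μ : GroupDistribution 𝒰 ℂ_[p]} (hμ : μ.bound ≤ 1)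
    (h : absoluteGaloisGroup K) : (GroupDistribution.twisting h 0 μ).bound ≤ 1 := by
  rwa [GroupDistribution.twisting_zero_bound]

end Galois

/-! ### §3. The attached `ℤ_p²`-distribution of the translate: a unit character factor -/

section Quotient

variable {p : ℕ} [Fact p.Prime]

/-- **A continuous character of `ℤ_p²` has values of norm exactly `1`**: `z ↦ ‖F z‖` is a continuous
homomorphism from a compact group to `ℝ_{>0}`, so its image is `{1}` (the maximum `M = ‖F z₀‖` satisfies
`M² = ‖F(2z₀)‖ ≤ M`, whence `M ≤ 1`; and `‖F z‖·‖F(−z)‖ = ‖F 0‖ = 1`). [cite: Washington1997, §13.1] -/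
theorem IsContinuousChar₂.norm_apply_eq_one {F : ℤ_[p] × ℤ_[p] → ℂ_[p]} (hF : IsContinuousChar₂ F)
    (z : ℤ_[p] × ℤ_[p]) : ‖F z‖ = 1 := by
  have hcont : Continuous fun w ↦ ‖F w‖ := hF.continuous.norm
  obtain ⟨z₀, -, hmax⟩ := isCompact_univ.exists_isMaxOn Set.univ_nonempty hcont.continuousOn
  have hle : ∀ w, ‖F w‖ ≤ ‖F z₀‖ := fun w ↦ hmax (Set.mem_univ w)
  have h0 : F 0 = 1 := hF.map_zero
  have hM1 : ‖F z₀‖ ≤ 1 := by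
    have h2 : ‖F (z₀ + z₀)‖ = ‖F z₀‖ * ‖F z₀‖ := by rw [hF.map_add, norm_mul]
    have hpos : 0 < ‖F z₀‖ := by
      have h1 : (1 : ℝ) ≤ ‖F z₀‖ := by simpa [h0] using hle 0
      linarith
    nlinarith [hle (z₀ + z₀)]
  have hle1 : ∀ w, ‖F w‖ ≤ 1 := fun w ↦ (hle w).trans hM1
  have hprod : ‖F z‖ * ‖F (-z)‖ = 1 := by
    rw [← norm_mul, ← hF.map_add, add_neg_cancel, h0, norm_one]
  have hz := hle1 z
  have hnz := hle1 (-z)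
  nlinarith [norm_nonneg (F z), norm_nonneg (F (-z))]

variable {K : Type} [Field K] [NumberField K] {𝒰 : SubgroupTower (absoluteGaloisGroup K)}
  [∀ n, (𝒰.U n).Normal] {κ₁ κ₂ : ZpExtension K p}

/-- **`∫ F d(π_*(l·δ_{h,0}μ)) = l(h) · F(κ₁h, κ₂h) · ∫ F d(π_*(l·μ))`** for every bounded uniformly continuous
CHARACTER `F` of `ℤ_p²` (`F(z + w) = F z · F w`): change of variables (`integral_katzDistribution₂`), translation
(`integral_twisting_zero`), additivity of the coordinates (`pairCoord_mul`) and multiplicativity of `l` and `F`.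
[cite: deShalit1987, II.4.16 (49) (p. 76), II.4.17 (54) (p. 78)] -/
theorem integral_katzDistribution₂_twisting_zero (μ : GroupDistribution 𝒰 ℂ_[p])
    (hpc : 𝒰.IsTowerContinuous (ZpExtension.pairCoord κ₁ κ₂))
    (l : FramedGaloisRep K (PadicAlgCl p) 1) (hl : 𝒰.IsTowerContinuous (fun σ ↦ avatarValueAt l σ))
    (h : absoluteGaloisGroup K) {F : ℤ_[p] × ℤ_[p] → ℂ_[p]} (hFc : UniformContinuous F) {M : ℝ}
    (hM : ∀ x, ‖F x‖ ≤ M) (hadd : ∀ z w, F (z + w) = F z * F w) :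
    (katzDistribution₂ (GroupDistribution.twisting h 0 μ) hpc l hl).integral F =
      avatarValueAt l h * F (ZpExtension.pairCoord κ₁ κ₂ h) * (katzDistribution₂ μ hpc l hl).integral F := by
  have hint : 𝒰.IsTowerContinuous (fun σ ↦ F (ZpExtension.pairCoord κ₁ κ₂ σ) * avatarValueAt l σ) :=
    (hpc.comp_uniformContinuous hFc).mul hl (M := max M 1) (fun σ ↦ (hM _).trans (le_max_left _ _))
      (fun σ ↦ (norm_avatarValueAt_eq_one l σ).le.trans (le_max_right _ _))
  rw [integral_katzDistribution₂ _ hpc l hl hFc hM, integral_katzDistribution₂ _ hpc l hl hFc hM,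
    GroupDistribution.integral_twisting_zero h μ hint, ← μ.integral_const_mul _ hint]
  refine μ.integral_congr fun σ ↦ ?_
  rw [ZpExtension.pairCoord_mul, hadd, avatarValueAt_mul]
  ring

/-- The same for a continuous character `F` of `ℤ_p²` in the sense of `IsContinuousChar₂` (values of norm `1`,
uniformly continuous on the compact group). [cite: deShalit1987, II.4.17 (54) (p. 78)] -/
theorem integral_katzDistribution₂_twisting_zero_of_isContinuousChar₂ (μ : GroupDistribution 𝒰 ℂ_[p])
    (hpc : 𝒰.IsTowerContinuous (ZpExtension.pairCoord κ₁ κ₂))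
    (l : FramedGaloisRep K (PadicAlgCl p) 1) (hl : 𝒰.IsTowerContinuous (fun σ ↦ avatarValueAt l σ))
    (h : absoluteGaloisGroup K) {F : ℤ_[p] × ℤ_[p] → ℂ_[p]} (hF : IsContinuousChar₂ F) :
    (katzDistribution₂ (GroupDistribution.twisting h 0 μ) hpc l hl).integral F =
      avatarValueAt l h * F (ZpExtension.pairCoord κ₁ κ₂ h) * (katzDistribution₂ μ hpc l hl).integral F :=
  integral_katzDistribution₂_twisting_zero μ hpc l hl h hF.uniformContinuous
    (fun x ↦ (hF.norm_apply_eq_one x).le) hF.map_add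

/-- **SAME NORM**: `‖∫ F d(π_*(l·δ_{h,0}μ))‖ = ‖∫ F d(π_*(l·μ))‖` for every continuous character `F` of `ℤ_p²`
(the factor `l(h)·F(κ₁h, κ₂h)` is a unit of norm `1`). This is the invariance read by the value-formula consumer
of the print leaf (`‖G₂(x, y)‖`). [cite: deShalit1987, II.4.17 (54) (p. 78)] -/
theorem norm_integral_katzDistribution₂_twisting_zero (μ : GroupDistribution 𝒰 ℂ_[p])
    (hpc : 𝒰.IsTowerContinuous (ZpExtension.pairCoord κ₁ κ₂))
    (l : FramedGaloisRep K (PadicAlgCl p) 1) (hl : 𝒰.IsTowerContinuous (fun σ ↦ avatarValueAt l σ))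
    (h : absoluteGaloisGroup K) {F : ℤ_[p] × ℤ_[p] → ℂ_[p]} (hF : IsContinuousChar₂ F) :
    ‖(katzDistribution₂ (GroupDistribution.twisting h 0 μ) hpc l hl).integral F‖ =
      ‖(katzDistribution₂ μ hpc l hl).integral F‖ := by
  rw [integral_katzDistribution₂_twisting_zero_of_isContinuousChar₂ μ hpc l hl h hF, norm_mul, norm_mul,
    norm_avatarValueAt_eq_one, hF.norm_apply_eq_one, one_mul, one_mul]

/-- **The two-variable Amice transforms at a character point**: at `(x, y) = (F(1,0) − 1, F(0,1) − 1)` the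
transform of `π_*(l·δ_{h,0}μ)` takes the value `l(h)·F(κ₁h, κ₂h)` times the value of the transform of `π_*(l·μ)`
(both bounds `≤ 1`): `G′(x, y) = u(x, y)·G(x, y)` with `‖u(x, y)‖ = 1`. [cite: deShalit1987, II.4.17 (52)–(54) (p. 77–78)] -/
theorem hasValueAt₂_amice₂Int_twisting_zero (μ : GroupDistribution 𝒰 ℂ_[p])
    (hpc : 𝒰.IsTowerContinuous (ZpExtension.pairCoord κ₁ κ₂))
    (l : FramedGaloisRep K (PadicAlgCl p) 1) (hl : 𝒰.IsTowerContinuous (fun σ ↦ avatarValueAt l σ))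
    (h : absoluteGaloisGroup K) {F : ℤ_[p] × ℤ_[p] → ℂ_[p]} (hF : IsContinuousChar₂ F)
    (hb' : (katzDistribution₂ (GroupDistribution.twisting h 0 μ) hpc l hl).bound ≤ 1) :
    IntSeries.HasValueAt₂ ((katzDistribution₂ (GroupDistribution.twisting h 0 μ) hpc l hl).amice₂Int hb')
      (F (1, 0) - 1) (F (0, 1) - 1)
      (avatarValueAt l h * F (ZpExtension.pairCoord κ₁ κ₂ h) * (katzDistribution₂ μ hpc l hl).integral F) := by
  rw [← integral_katzDistribution₂_twisting_zero_of_isContinuousChar₂ μ hpc l hl h hF]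
  exact BoundedDistribution.hasValueAt₂_amice₂Int _ hb' hF

end Quotient

end Literature.NumberTheory.EllipticCurves

end
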